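import Literature.Geometry.Riemannian.DistanceLaplacianComparison
import Literature.Geometry.Riemannian.DirectionalBarrierMaximumPrinciple
import HarnessLib

/-!
# Laplacian comparison for radial functions `G(d(p, ·))`, `G` nonincreasing, in the viscosity
# sense, and the comparison principle against smooth strict solutions

Continuation of `DistanceLaplacianComparison.lean`. In the Cheeger–Colding theory (Cheeger–Colding
1996, §1; Abresch–Gromoll; Cheeger–Colding 1997) the Laplacian comparison
`Δr ≤ (m-1) coth r` (`r = d(p, ·)`, `Ric ≥ -(m-1)`) is used through COMPARISON FUNCTIONS
`G ∘ r` with `G' ≤ 0` — for which it yields the LOWER bound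
  `Δ(G ∘ r) ≥ G''(r) + (m-1) coth(r) G'(r)`  ("`= Δ_{ℍᵐ}(G ∘ r)`")
in the barrier sense — and through the maximum principle against smooth solutions of Poisson
equations. We PROVE:

* `le_laplaceBeltrami_of_directional_barriers_antitone` — the abstract step: directional
  second-order upper barriers for `r` at `x` with trace bound `S` give, for `G` nonincreasing and
  `C²` near `T = r(x)` and every `C²` function `φ` near `x` with `G ∘ r - φ` locally maximal at
  `x` (e.g. `φ ≥ G ∘ r` near `x`, `φ(x) = G(T)`), `G''(T) + S G'(T) ≤ Δ_g φ(x)`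
  (`le_hessian_of_directional_lower_barrier` in each direction of the frame: the lower barriers
  `G(T + σ)` radially and `G(T + (Qₒ + εT)σ²/2)` transversally);
* `laplaceBeltrami_le_of_directional_barriers_monotone`, `laplaceBeltrami_le_comp_edist_of_monotone`
  (`_of_ricci_nonneg`) — the mirror statements for NONDECREASING `G`:
  `Δ(G ∘ d(p,·)) ≤ G'' + (m-1) coth(d) G'` in the viscosity sense (test functions from below;
  `G = id` is `laplaceBeltrami_le_coth_of_le_edist`);
* `le_laplaceBeltrami_comp_edist_of_antitone` — **`Ric ≥ -(m-1) g` ⟹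
  `Δ(G ∘ d(p,·)) ≥ G'' + (m-1) coth(d) G'` in the viscosity sense on `M ∖ {p}`** for
  nonincreasing `G` (Cheeger–Colding 1996, §1, the use of "Laplacian comparison" for the
  functions `G(r)`; Petersen 2016, Lemma 7.1.9 ff.); `le_laplaceBeltrami_comp_edist_of_antitone_of_ricci_nonneg` — the same under
  `Ric ≥ 0` with `(m-1)/d`;
* `le_of_viscosity_subsolution`, `le_of_viscosity_supersolution` — **the comparison
  principle**: on a compact `K` with an open `Ω ⊆ K`, a viscosity subsolution `u` of `Δu ≥ F` on
  `Ω` (every `C²` function `φ` with `u - φ` locally maximal at `x` has `Δφ(x) ≥ F(x)`) lies below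
  every `b ∈ C²(Ω)` with `Δb < F` on `Ω` and `u ≤ b` on `K ∖ Ω` (`u - b` usc on `K`); and the
  mirror statement for supersolutions (e.g. `d(p, ·)` itself, `DistanceLaplacianComparison.lean`).

Everything here is proved; no definitions, no named facts (D-0026). Groundwork for
`CheegerColding1997_sphereStability`.

## References

* J. Cheeger, T. H. Colding, *Lower bounds on Ricci curvature and the almost rigidity of warped
  products*, Ann. of Math. 144 (1996) 189–237, §1. [CheegerColding1996]
* E. Calabi, Duke Math. J. 25 (1958) 45–56. [Calabi1958]
* P. Petersen, *Riemannian Geometry*, 3rd ed. (2016), Lemma 7.1.9 and §7.1.3. [Petersen2016]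
-/

noncomputable section

open Bundle Set Function Filter MeasureTheory intervalIntegral
open scoped Manifold ContDiff Topology ENNReal NNReal Real

namespace Literature.Geometry.Riemannian

open Lorentzian Lorentzian.PseudoRiemannianMetric

section Radial

variable {E : Type*} [NormedAddCommGroup E] [NormedSpace ℝ E] [FiniteDimensional ℝ E]
  [CompleteSpace E] {M : Type*} [TopologicalSpace M] [ChartedSpace E M] [IsManifold 𝓘(ℝ, E) ∞ M]
  [T2Space M]
  (g : PseudoRiemannianMetric 𝓘(ℝ, E) ∞ E (TangentSpace 𝓘(ℝ, E) : M → Type _)) [g.HasLeviCivita]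
  [CovariantDerivative.ContMDiffCovariantDerivative g.leviCivita 1]
  [CovariantDerivative.ContMDiffCovariantDerivative g.leviCivita ∞]

/-- The derivative of a function nonincreasing near `T` is `≤ 0` at `T`. [folklore] -/
theorem hasDerivAt_nonpos_of_antitoneOn {G : ℝ → ℝ} {G'T T δ : ℝ} (hδ : 0 < δ)
    (hanti : AntitoneOn G (Ioo (T - δ) (T + δ))) (hG : HasDerivAt G G'T T) : G'T ≤ 0 := by
  have hslope := hasDerivAt_iff_tendsto_slope.1 hG
  have hT : T ∈ Ioo (T - δ) (T + δ) := ⟨by linarith, by linarith⟩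
  refine le_of_tendsto hslope ?_
  rw [eventually_nhdsWithin_iff]
  filter_upwards [isOpen_Ioo.mem_nhds hT] with s hs hsT
  have hne : s ≠ T := hsT
  rw [slope_def_field]
  rcases lt_or_gt_of_ne hne with h | h
  · exact div_nonpos_of_nonneg_of_nonpos (by linarith [hanti hs hT h.le]) (by linarith)
  · exact div_nonpos_of_nonpos_of_nonneg (by linarith [hanti hT hs h.le]) (by linarith)

omit [CovariantDerivative.ContMDiffCovariantDerivative g.leviCivita ∞] in
/-- **From directional upper barriers for `r = d(p, ·)` at `x` to `Δφ(x) ≥ G″(T) + S G′(T)` for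
`C²` upper support functions `φ` of `G ∘ r` at `x`, `G` nonincreasing near `T = r(x)`.** Data:
a `g_x`-orthonormal frame `f` (`card = dim M`), the radial barrier `r(exp_x(σ f none)) ≤ T + σ`
(`|σ| < T`), transverse barriers `r(exp_x(σ f o)) ≤ T + [o = none]σ + (Q o + εT)σ²/2` for `σ`
near `0` (every `ε > 0`), and `Σₒ Q o − Q none ≤ S`. Then along `f none` the function
`G(T + σ)` and along `f o`, `o ≠ none`, the functions `G(T + (Q o + εT)σ²/2)` are LOWER barriers
for `G ∘ r`, hence for `φ`; `le_hessian_of_directional_lower_barrier` and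
`Δφ = Σ Hess φ(f o, f o)`, `G′(T) ≤ 0`, `ε → 0`. [folklore] -/
theorem le_laplaceBeltrami_of_directional_barriers_antitone [ConnectedSpace M] (hg : g.IsRiemannian)
    (hc : IsGeodesicallyComplete g.leviCivita) {p x : M} {T : ℝ} (hT : 0 < T)
    (hTx : T = (g.edist hg p x).toReal) {k : ℕ} {f : Option (Fin k) → TangentSpace 𝓘(ℝ, E) x}
    {Q : Option (Fin k) → ℝ} {S : ℝ} (hcard : Fintype.card (Option (Fin k)) = Module.finrank ℝ E)
    (hon : ∀ o o', g.val x (f o) (f o') = if o = o' then 1 else 0)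
    (hrad : ∀ σ ∈ Ioo (-T) T,
      (g.edist hg p (expMap g.leviCivita x (σ • f none))).toReal ≤ T + σ)
    (hbar : ∀ o, ∀ ε > 0, ∀ᶠ σ in 𝓝 (0 : ℝ),
      (g.edist hg p (expMap g.leviCivita x (σ • f o))).toReal ≤
        T + (if o = none then σ else 0) + (Q o + ε * T) / 2 * σ ^ 2)
    (hsum : (∑ o, Q o) - Q none ≤ S)
    {G G' : ℝ → ℝ} {G2 δ : ℝ} (hδ : 0 < δ) (hGd : ∀ s ∈ Ioo (T - δ) (T + δ), HasDerivAt G (G' s) s)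
    (hG2 : HasDerivAt G' G2 T) (hanti : AntitoneOn G (Ioo (T - δ) (T + δ)))
    {φ : M → ℝ} (hφ : ∀ᶠ x' in 𝓝 x, ContMDiffAt 𝓘(ℝ, E) 𝓘(ℝ, ℝ) 2 φ x')
    (hmax : IsLocalMax (fun x' ↦ G (g.edist hg p x').toReal - φ x') x) :
    G2 + S * G' T ≤ g.laplaceBeltrami φ x := by
  classical
  haveI : Fact ((1 : ℕ∞ω) ≤ (∞ : ℕ∞ω)) := ⟨by exact_mod_cast le_top⟩
  haveI : LocallyCompactSpace M := Manifold.locallyCompact_of_finiteDimensional 𝓘(ℝ, E)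
  haveI : RegularSpace M := inferInstance
  have hTint : T ∈ Ioo (T - δ) (T + δ) := ⟨by linarith, by linarith⟩
  have hG'T : G' T ≤ 0 := hasDerivAt_nonpos_of_antitoneOn hδ hanti (hGd T hTint)
  -- the curves `σ ↦ exp_x(σ f o)` are continuous at `0`, start at `x`; `r` along them
  have hcurve : ∀ o, Tendsto (fun σ : ℝ ↦ expMap g.leviCivita x (σ • f o)) (𝓝 0) (𝓝 x) := by
    intro o
    have hgeo : IsGeodesic g.leviCivita (fun σ : ℝ ↦ expMap g.leviCivita x (σ • f o)) :=
      isGeodesic_expMap_smul_of_isGeodesicallyComplete hc x (f o)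
    have hcont : ContinuousAt (fun σ : ℝ ↦ expMap g.leviCivita x (σ • f o)) 0 :=
      (IsGeodesicOn.mdifferentiableAt_holds (hgeo.isGeodesicOn univ) (mem_univ 0)).continuousAt
    have h0 : expMap g.leviCivita x ((0 : ℝ) • f o) = x := by
      rw [zero_smul]; exact expMap_zero (cov := g.leviCivita) x
    have h := hcont.tendsto
    rwa [h0] at h
  set r : M → ℝ := fun y ↦ (g.edist hg p y).toReal with hr_def
  have hrx : r x = T := hTx.symm
  have hrcont : ContinuousAt r x := by
    have h1 : Continuous fun y ↦ g.edist hg p y :=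
      (continuous_edist hg).comp (continuous_const.prodMk continuous_id)
    exact (ENNReal.continuousAt_toReal (edist_ne_top hg p x)).comp h1.continuousAt
  -- along each curve, eventually: `r ∈ (T - δ, T + δ)` and `φ ≥ G ∘ r`
  have hrint : ∀ o, ∀ᶠ σ in 𝓝 (0 : ℝ), r (expMap g.leviCivita x (σ • f o)) ∈ Ioo (T - δ) (T + δ) :=
    fun o ↦ (hcurve o).eventually (hrcont.preimage_mem_nhds (by rw [hrx]; exact isOpen_Ioo.mem_nhds hTint))
  have hgeo' : ∀ o, ∀ᶠ σ in 𝓝 (0 : ℝ), G (r (expMap g.leviCivita x (σ • f o))) -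
      φ (expMap g.leviCivita x (σ • f o)) ≤ G (r x) - φ x := fun o ↦ (hcurve o).eventually hmax
  have h0 : ∀ o, expMap g.leviCivita x ((0 : ℝ) • f o) = x := fun o ↦ by
    rw [zero_smul]; exact expMap_zero (cov := g.leviCivita) x
  -- the radial direction: `G2 ≤ Hess φ (f none, f none)`
  have hnone : G2 ≤ g.hessian φ x (f none) (f none) := by
    have hsmall : ∀ᶠ σ in 𝓝 (0 : ℝ), T + σ ∈ Ioo (T - δ) (T + δ) := by
      filter_upwards [Ioo_mem_nhds (show -δ < 0 by linarith) hδ] with σ hσ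
      exact ⟨by linarith [hσ.1], by linarith [hσ.2]⟩
    refine le_hessian_of_directional_lower_barrier g hc hφ (f none) (B := fun σ ↦ G (T + σ))
      (B' := fun σ ↦ G' (T + σ)) ?_ ?_ ?_
    · filter_upwards [hsmall] with σ hσ
      exact (hGd _ hσ).comp_const_add T σ
    · have h : HasDerivAt G' G2 (T + 0) := by rw [add_zero]; exact hG2
      exact h.comp_const_add T 0
    · -- local maximum of `G(T + σ) - φ(exp(σ f none))` at `0`
      have hIoo : Ioo (-T) T ∈ 𝓝 (0 : ℝ) := Ioo_mem_nhds (by linarith) hT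
      show ∀ᶠ σ in 𝓝 (0 : ℝ), G (T + σ) - φ (expMap g.leviCivita x (σ • f none)) ≤
        G (T + 0) - φ (expMap g.leviCivita x ((0 : ℝ) • f none))
      filter_upwards [hIoo, hsmall, hrint none, hgeo' none] with σ hσ hσ' hrσ hφσ
      rw [h0, add_zero]
      have h1 : G (T + σ) ≤ G (r (expMap g.leviCivita x (σ • f none))) :=
        hanti hrσ hσ' (hrad σ hσ)
      rw [hrx] at hφσ
      linarith
  -- the transverse directions
  have hsome : ∀ ε > 0, ∀ i : Fin k,
      (Q (some i) + ε * T) * G' T ≤ g.hessian φ x (f (some i)) (f (some i)) := by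
    intro ε hε i
    set c : ℝ := (Q (some i) + ε * T) / 2 with hc_def
    -- where the argument `T + c σ²` stays in the interval
    have hsmall : ∀ᶠ σ in 𝓝 (0 : ℝ), T + c * (σ * σ) ∈ Ioo (T - δ) (T + δ) := by
      have hct : Tendsto (fun σ : ℝ ↦ T + c * (σ * σ)) (𝓝 0) (𝓝 (T + c * (0 * 0))) :=
        ((continuous_const.add (continuous_const.mul (continuous_id.mul continuous_id))).tendsto 0)
      rw [mul_zero, mul_zero, add_zero] at hct
      exact hct.eventually (isOpen_Ioo.mem_nhds hTint)
    refine le_hessian_of_directional_lower_barrier g hc hφ (f (some i))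
      (B := fun σ ↦ G (T + c * (σ * σ))) (B' := fun σ ↦ G' (T + c * (σ * σ)) * (c * (σ + σ)))
      ?_ ?_ ?_
    · filter_upwards [hsmall] with σ hσ
      have hin : HasDerivAt (fun σ ↦ T + c * (σ * σ)) (c * (1 * σ + σ * 1)) σ :=
        (((hasDerivAt_id σ).mul (hasDerivAt_id σ)).const_mul c).const_add T
      exact ((hGd _ hσ).comp σ hin).congr_deriv (by ring)
    · have hin0 : HasDerivAt (fun σ ↦ T + c * (σ * σ)) (c * (1 * 0 + 0 * 1)) 0 :=
        (((hasDerivAt_id (0 : ℝ)).mul (hasDerivAt_id 0)).const_mul c).const_add T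
      have hG2' : HasDerivAt G' G2 (T + c * (0 * 0)) := by
        rw [mul_zero, mul_zero, add_zero]; exact hG2
      have h1 : HasDerivAt (fun σ ↦ G' (T + c * (σ * σ))) (G2 * (c * (1 * 0 + 0 * 1))) 0 :=
        hG2'.comp 0 hin0
      have h2 : HasDerivAt (fun σ : ℝ ↦ c * (σ + σ)) (c * (1 + 1)) 0 :=
        ((hasDerivAt_id (0 : ℝ)).add (hasDerivAt_id 0)).const_mul c
      have h3 := h1.mul h2
      refine h3.congr_deriv ?_
      simp only [mul_zero, add_zero, zero_add, mul_one]
      rw [hc_def]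
      ring
    · show ∀ᶠ σ in 𝓝 (0 : ℝ), G (T + c * (σ * σ)) - φ (expMap g.leviCivita x (σ • f (some i))) ≤
        G (T + c * (0 * 0)) - φ (expMap g.leviCivita x ((0 : ℝ) • f (some i)))
      filter_upwards [hbar (some i) ε hε, hsmall, hrint (some i), hgeo' (some i)]
        with σ hσ hσ' hrσ hφσ
      rw [h0, mul_zero, mul_zero, add_zero]
      rw [hrx] at hφσ
      simp only [reduceCtorEq, if_false, add_zero] at hσ
      have hle : (g.edist hg p (expMap g.leviCivita x (σ • f (some i)))).toReal ≤
          T + c * (σ * σ) := by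
        rw [hc_def]
        have : (Q (some i) + ε * T) / 2 * σ ^ 2 = (Q (some i) + ε * T) / 2 * (σ * σ) := by
          rw [sq]
        linarith [hσ, this]
      have h1 : G (T + c * (σ * σ)) ≤ G (r (expMap g.leviCivita x (σ • f (some i)))) :=
        hanti hrσ hσ' hle
      linarith
  -- sum over the frame, `G'(T) ≤ 0`, and `ε → 0`
  rw [laplaceBeltrami_eq_sum_hessian g x hon hcard φ, Fintype.sum_option]
  have hQ : (∑ o, Q o) - Q none = ∑ i : Fin k, Q (some i) := by
    rw [Fintype.sum_option]; ring
  rw [hQ] at hsum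
  have hSG : S * G' T ≤ (∑ i : Fin k, Q (some i)) * G' T := mul_le_mul_of_nonpos_right hsum hG'T
  refine le_of_forall_pos_le_add fun ε' hε' ↦ ?_
  have hkT : 0 < (k : ℝ) * T * (-G' T) + 1 := by
    have := mul_nonneg (mul_nonneg (Nat.cast_nonneg k) hT.le) (neg_nonneg.2 hG'T); linarith
  set ε : ℝ := ε' / ((k : ℝ) * T * (-G' T) + 1) with hε_def
  have hε : 0 < ε := div_pos hε' hkT
  have hsum' : ∑ i : Fin k, (Q (some i) + ε * T) * G' T ≤
      ∑ i : Fin k, g.hessian φ x (f (some i)) (f (some i)) :=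
    Finset.sum_le_sum fun i _ ↦ hsome ε hε i
  have hL : ∑ i : Fin k, (Q (some i) + ε * T) * G' T =
      (∑ i : Fin k, Q (some i)) * G' T + (k : ℝ) * (ε * T) * G' T := by
    rw [← Finset.sum_mul, Finset.sum_add_distrib, Finset.sum_const, Finset.card_univ,
      Fintype.card_fin, nsmul_eq_mul]
    ring
  rw [hL] at hsum'
  have hkε : (k : ℝ) * (ε * T) * (-G' T) ≤ ε' := by
    have h1 : ((k : ℝ) * T * (-G' T) + 1) * ε - (k : ℝ) * (ε * T) * (-G' T) = ε := by ring
    have h2 : ((k : ℝ) * T * (-G' T) + 1) * ε = ε' := by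
      rw [hε_def]; exact mul_div_cancel₀ ε' hkT.ne'
    linarith [hε.le]
  linarith [hsum', hSG, hnone, hkε]

omit [CovariantDerivative.ContMDiffCovariantDerivative g.leviCivita ∞] in
/-- **From directional upper barriers for `r = d(p, ·)` at `x` to `Δφ(x) ≤ G″(T) + S G′(T)` for
`C²` lower support functions `φ` of `G ∘ r` at `x`, `G` nondecreasing near `T = r(x)`** (the
mirror of `le_laplaceBeltrami_of_directional_barriers_antitone`; with `G = id` it is
`laplaceBeltrami_le_of_directional_barriers`). Data:
a `g_x`-orthonormal frame `f` (`card = dim M`), the radial barrier `r(exp_x(σ f none)) ≤ T + σ`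
(`|σ| < T`), transverse barriers `r(exp_x(σ f o)) ≤ T + [o = none]σ + (Q o + εT)σ²/2` for `σ`
near `0` (every `ε > 0`), and `Σₒ Q o − Q none ≤ S`. Then along `f none` the function
`G(T + σ)` and along `f o`, `o ≠ none`, the functions `G(T + (Q o + εT)σ²/2)` are UPPER barriers
for `G ∘ r`, hence for `φ`; `hessian_le_of_directional_barrier` and `Δφ = Σ Hess φ(f o, f o)`,
`G′(T) ≥ 0`, `ε → 0`. [folklore] -/
theorem laplaceBeltrami_le_of_directional_barriers_monotone [ConnectedSpace M] (hg : g.IsRiemannian)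
    (hc : IsGeodesicallyComplete g.leviCivita) {p x : M} {T : ℝ} (hT : 0 < T)
    (hTx : T = (g.edist hg p x).toReal) {k : ℕ} {f : Option (Fin k) → TangentSpace 𝓘(ℝ, E) x}
    {Q : Option (Fin k) → ℝ} {S : ℝ} (hcard : Fintype.card (Option (Fin k)) = Module.finrank ℝ E)
    (hon : ∀ o o', g.val x (f o) (f o') = if o = o' then 1 else 0)
    (hrad : ∀ σ ∈ Ioo (-T) T,
      (g.edist hg p (expMap g.leviCivita x (σ • f none))).toReal ≤ T + σ)
    (hbar : ∀ o, ∀ ε > 0, ∀ᶠ σ in 𝓝 (0 : ℝ),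
      (g.edist hg p (expMap g.leviCivita x (σ • f o))).toReal ≤
        T + (if o = none then σ else 0) + (Q o + ε * T) / 2 * σ ^ 2)
    (hsum : (∑ o, Q o) - Q none ≤ S)
    {G G' : ℝ → ℝ} {G2 δ : ℝ} (hδ : 0 < δ) (hGd : ∀ s ∈ Ioo (T - δ) (T + δ), HasDerivAt G (G' s) s)
    (hG2 : HasDerivAt G' G2 T) (hmono : MonotoneOn G (Ioo (T - δ) (T + δ)))
    {φ : M → ℝ} (hφ : ∀ᶠ x' in 𝓝 x, ContMDiffAt 𝓘(ℝ, E) 𝓘(ℝ, ℝ) 2 φ x')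
    (hmin : IsLocalMin (fun x' ↦ G (g.edist hg p x').toReal - φ x') x) :
    g.laplaceBeltrami φ x ≤ G2 + S * G' T := by
  classical
  haveI : Fact ((1 : ℕ∞ω) ≤ (∞ : ℕ∞ω)) := ⟨by exact_mod_cast le_top⟩
  haveI : LocallyCompactSpace M := Manifold.locallyCompact_of_finiteDimensional 𝓘(ℝ, E)
  haveI : RegularSpace M := inferInstance
  have hTint : T ∈ Ioo (T - δ) (T + δ) := ⟨by linarith, by linarith⟩
  have hG'T : 0 ≤ G' T := by
    have h := hasDerivAt_nonpos_of_antitoneOn (G := fun s ↦ -G s) hδ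
      (fun a ha b hb hab ↦ neg_le_neg (hmono ha hb hab)) (hGd T hTint).neg
    linarith
  -- the curves `σ ↦ exp_x(σ f o)` are continuous at `0`, start at `x`; `r` along them
  have hcurve : ∀ o, Tendsto (fun σ : ℝ ↦ expMap g.leviCivita x (σ • f o)) (𝓝 0) (𝓝 x) := by
    intro o
    have hgeo : IsGeodesic g.leviCivita (fun σ : ℝ ↦ expMap g.leviCivita x (σ • f o)) :=
      isGeodesic_expMap_smul_of_isGeodesicallyComplete hc x (f o)
    have hcont : ContinuousAt (fun σ : ℝ ↦ expMap g.leviCivita x (σ • f o)) 0 :=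
      (IsGeodesicOn.mdifferentiableAt_holds (hgeo.isGeodesicOn univ) (mem_univ 0)).continuousAt
    have h0 : expMap g.leviCivita x ((0 : ℝ) • f o) = x := by
      rw [zero_smul]; exact expMap_zero (cov := g.leviCivita) x
    have h := hcont.tendsto
    rwa [h0] at h
  set r : M → ℝ := fun y ↦ (g.edist hg p y).toReal with hr_def
  have hrx : r x = T := hTx.symm
  have hrcont : ContinuousAt r x := by
    have h1 : Continuous fun y ↦ g.edist hg p y :=
      (continuous_edist hg).comp (continuous_const.prodMk continuous_id)
    exact (ENNReal.continuousAt_toReal (edist_ne_top hg p x)).comp h1.continuousAt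
  -- along each curve, eventually: `r ∈ (T - δ, T + δ)` and `φ ≥ G ∘ r`
  have hrint : ∀ o, ∀ᶠ σ in 𝓝 (0 : ℝ), r (expMap g.leviCivita x (σ • f o)) ∈ Ioo (T - δ) (T + δ) :=
    fun o ↦ (hcurve o).eventually (hrcont.preimage_mem_nhds (by rw [hrx]; exact isOpen_Ioo.mem_nhds hTint))
  have hgeo' : ∀ o, ∀ᶠ σ in 𝓝 (0 : ℝ), G (r x) - φ x ≤ G (r (expMap g.leviCivita x (σ • f o))) -
      φ (expMap g.leviCivita x (σ • f o)) := fun o ↦ (hcurve o).eventually hmin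
  have h0 : ∀ o, expMap g.leviCivita x ((0 : ℝ) • f o) = x := fun o ↦ by
    rw [zero_smul]; exact expMap_zero (cov := g.leviCivita) x
  -- the radial direction: `Hess φ (f none, f none) ≤ G2`
  have hnone : g.hessian φ x (f none) (f none) ≤ G2 := by
    have hsmall : ∀ᶠ σ in 𝓝 (0 : ℝ), T + σ ∈ Ioo (T - δ) (T + δ) := by
      filter_upwards [Ioo_mem_nhds (show -δ < 0 by linarith) hδ] with σ hσ
      exact ⟨by linarith [hσ.1], by linarith [hσ.2]⟩
    refine hessian_le_of_directional_barrier g hc hφ (f none) (B := fun σ ↦ G (T + σ))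
      (B' := fun σ ↦ G' (T + σ)) ?_ ?_ ?_
    · filter_upwards [hsmall] with σ hσ
      exact (hGd _ hσ).comp_const_add T σ
    · have h : HasDerivAt G' G2 (T + 0) := by rw [add_zero]; exact hG2
      exact h.comp_const_add T 0
    · -- local minimum of `G(T + σ) - φ(exp(σ f none))` at `0`
      have hIoo : Ioo (-T) T ∈ 𝓝 (0 : ℝ) := Ioo_mem_nhds (by linarith) hT
      show ∀ᶠ σ in 𝓝 (0 : ℝ), G (T + 0) - φ (expMap g.leviCivita x ((0 : ℝ) • f none)) ≤
        G (T + σ) - φ (expMap g.leviCivita x (σ • f none))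
      filter_upwards [hIoo, hsmall, hrint none, hgeo' none] with σ hσ hσ' hrσ hφσ
      rw [h0, add_zero]
      have h1 : G (r (expMap g.leviCivita x (σ • f none))) ≤ G (T + σ) :=
        hmono hrσ hσ' (hrad σ hσ)
      rw [hrx] at hφσ
      linarith
  -- the transverse directions
  have hsome : ∀ ε > 0, ∀ i : Fin k,
      g.hessian φ x (f (some i)) (f (some i)) ≤ (Q (some i) + ε * T) * G' T := by
    intro ε hε i
    set c : ℝ := (Q (some i) + ε * T) / 2 with hc_def
    -- where the argument `T + c σ²` stays in the interval
    have hsmall : ∀ᶠ σ in 𝓝 (0 : ℝ), T + c * (σ * σ) ∈ Ioo (T - δ) (T + δ) := by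
      have hct : Tendsto (fun σ : ℝ ↦ T + c * (σ * σ)) (𝓝 0) (𝓝 (T + c * (0 * 0))) :=
        ((continuous_const.add (continuous_const.mul (continuous_id.mul continuous_id))).tendsto 0)
      rw [mul_zero, mul_zero, add_zero] at hct
      exact hct.eventually (isOpen_Ioo.mem_nhds hTint)
    refine hessian_le_of_directional_barrier g hc hφ (f (some i))
      (B := fun σ ↦ G (T + c * (σ * σ))) (B' := fun σ ↦ G' (T + c * (σ * σ)) * (c * (σ + σ)))
      ?_ ?_ ?_
    · filter_upwards [hsmall] with σ hσ
      have hin : HasDerivAt (fun σ ↦ T + c * (σ * σ)) (c * (1 * σ + σ * 1)) σ :=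
        (((hasDerivAt_id σ).mul (hasDerivAt_id σ)).const_mul c).const_add T
      exact ((hGd _ hσ).comp σ hin).congr_deriv (by ring)
    · have hin0 : HasDerivAt (fun σ ↦ T + c * (σ * σ)) (c * (1 * 0 + 0 * 1)) 0 :=
        (((hasDerivAt_id (0 : ℝ)).mul (hasDerivAt_id 0)).const_mul c).const_add T
      have hG2' : HasDerivAt G' G2 (T + c * (0 * 0)) := by
        rw [mul_zero, mul_zero, add_zero]; exact hG2
      have h1 : HasDerivAt (fun σ ↦ G' (T + c * (σ * σ))) (G2 * (c * (1 * 0 + 0 * 1))) 0 :=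
        hG2'.comp 0 hin0
      have h2 : HasDerivAt (fun σ : ℝ ↦ c * (σ + σ)) (c * (1 + 1)) 0 :=
        ((hasDerivAt_id (0 : ℝ)).add (hasDerivAt_id 0)).const_mul c
      have h3 := h1.mul h2
      refine h3.congr_deriv ?_
      simp only [mul_zero, add_zero, zero_add, mul_one]
      rw [hc_def]
      ring
    · show ∀ᶠ σ in 𝓝 (0 : ℝ), G (T + c * (0 * 0)) - φ (expMap g.leviCivita x ((0 : ℝ) • f (some i))) ≤
        G (T + c * (σ * σ)) - φ (expMap g.leviCivita x (σ • f (some i)))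
      filter_upwards [hbar (some i) ε hε, hsmall, hrint (some i), hgeo' (some i)]
        with σ hσ hσ' hrσ hφσ
      rw [h0, mul_zero, mul_zero, add_zero]
      rw [hrx] at hφσ
      simp only [reduceCtorEq, if_false, add_zero] at hσ
      have hle : (g.edist hg p (expMap g.leviCivita x (σ • f (some i)))).toReal ≤
          T + c * (σ * σ) := by
        rw [hc_def]
        have : (Q (some i) + ε * T) / 2 * σ ^ 2 = (Q (some i) + ε * T) / 2 * (σ * σ) := by
          rw [sq]
        linarith [hσ, this]
      have h1 : G (r (expMap g.leviCivita x (σ • f (some i)))) ≤ G (T + c * (σ * σ)) :=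
        hmono hrσ hσ' hle
      linarith
  -- sum over the frame, `G'(T) ≥ 0`, and `ε → 0`
  rw [laplaceBeltrami_eq_sum_hessian g x hon hcard φ, Fintype.sum_option]
  have hQ : (∑ o, Q o) - Q none = ∑ i : Fin k, Q (some i) := by
    rw [Fintype.sum_option]; ring
  rw [hQ] at hsum
  have hSG : (∑ i : Fin k, Q (some i)) * G' T ≤ S * G' T := mul_le_mul_of_nonneg_right hsum hG'T
  refine le_of_forall_pos_le_add fun ε' hε' ↦ ?_
  have hkT : 0 < (k : ℝ) * T * G' T + 1 := by
    have := mul_nonneg (mul_nonneg (Nat.cast_nonneg k) hT.le) hG'T; linarith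
  set ε : ℝ := ε' / ((k : ℝ) * T * G' T + 1) with hε_def
  have hε : 0 < ε := div_pos hε' hkT
  have hsum' : ∑ i : Fin k, g.hessian φ x (f (some i)) (f (some i)) ≤
      ∑ i : Fin k, (Q (some i) + ε * T) * G' T :=
    Finset.sum_le_sum fun i _ ↦ hsome ε hε i
  have hL : ∑ i : Fin k, (Q (some i) + ε * T) * G' T =
      (∑ i : Fin k, Q (some i)) * G' T + (k : ℝ) * (ε * T) * G' T := by
    rw [← Finset.sum_mul, Finset.sum_add_distrib, Finset.sum_const, Finset.card_univ,
      Fintype.card_fin, nsmul_eq_mul]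
    ring
  rw [hL] at hsum'
  have hkε : (k : ℝ) * (ε * T) * G' T ≤ ε' := by
    have h1 : ((k : ℝ) * T * G' T + 1) * ε - (k : ℝ) * (ε * T) * G' T = ε := by ring
    have h2 : ((k : ℝ) * T * G' T + 1) * ε = ε' := by
      rw [hε_def]; exact mul_div_cancel₀ ε' hkT.ne'
    linarith [hε.le]
  linarith [hsum', hSG, hnone, hkε]

/-- **Laplacian comparison for nonincreasing radial functions, `Ric ≥ -(m-1) g`, viscosity form**
(the form in which Cheeger–Colding 1996, §1 use "Laplacian comparison" for the comparison
functions `G(r)`; Petersen 2016, Lemma 7.1.9): on a connected Riemannian `m`-manifold with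
geodesically complete Levi-Civita connection and `Ric ≥ -(m-1) g`, let `x ≠ p`,
`T = d(p, x)`, `G` nonincreasing and differentiable on `(T - δ, T + δ)` with `G'`
differentiable at `T`. Then for every `φ`, `C²` near `x`, such that `G ∘ d(p, ·) - φ` has a local maximum at `x`
(e.g. an upper support function: `φ ≥ G ∘ d(p,·)` near `x`, `φ(x) = G(T)`):
`G''(T) + (m - 1) coth(T) G'(T) ≤ Δ_g φ(x)` — i.e. `Δ (G ∘ r) ≥ Δ_{ℍ}(G ∘ r)` in the
viscosity sense. [cite: CheegerColding1996, §1] [cite: Calabi1958] -/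
theorem le_laplaceBeltrami_comp_edist_of_antitone [ConnectedSpace M] (hg : g.IsRiemannian)
    (hc : IsGeodesicallyComplete g.leviCivita)
    (hRic : ∀ (x : M) (w : TangentSpace 𝓘(ℝ, E) x),
      -((Module.finrank ℝ E : ℝ) - 1) * g.val x w w ≤ g.leviCivita.ricci x w w)
    {p x : M} (hxp : x ≠ p) {G G' : ℝ → ℝ} {G2 δ : ℝ} (hδ : 0 < δ)
    (hGd : ∀ s ∈ Ioo ((g.edist hg p x).toReal - δ) ((g.edist hg p x).toReal + δ),
      HasDerivAt G (G' s) s)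
    (hG2 : HasDerivAt G' G2 (g.edist hg p x).toReal)
    (hanti : AntitoneOn G (Ioo ((g.edist hg p x).toReal - δ) ((g.edist hg p x).toReal + δ)))
    {φ : M → ℝ} (hφ : ∀ᶠ x' in 𝓝 x, ContMDiffAt 𝓘(ℝ, E) 𝓘(ℝ, ℝ) 2 φ x')
    (hmax : IsLocalMax (fun x' ↦ G (g.edist hg p x').toReal - φ x') x) :
    G2 + ((Module.finrank ℝ E : ℝ) - 1) *
      (Real.cosh (g.edist hg p x).toReal / Real.sinh (g.edist hg p x).toReal) *
        G' (g.edist hg p x).toReal ≤ g.laplaceBeltrami φ x := by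
  obtain ⟨u, T, hu, hT, hTx, hx⟩ := exists_unit_speed_expMap_eq_of_ne g hg hc hxp
  subst hx
  obtain ⟨k, f, Q, hcard, hon, -, hrad, hbar, hsum⟩ := far_end_sinh_datum g hg hc hRic p u hu hT
  rw [← hTx] at hGd hG2 hanti ⊢
  exact le_laplaceBeltrami_of_directional_barriers_antitone g hg hc hT hTx hcard hon hrad hbar hsum
    hδ hGd hG2 hanti hφ hmax

/-- **Laplacian comparison for nonincreasing radial functions, `Ric ≥ 0`, viscosity form**: as
`le_laplaceBeltrami_comp_edist_of_antitone` with `Ric ≥ 0` and the Euclidean model,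
`G''(T) + ((m - 1)/T) G'(T) ≤ Δ_g φ(x)`. [cite: CheegerColding1996, §1] [cite: Calabi1958] -/
theorem le_laplaceBeltrami_comp_edist_of_antitone_of_ricci_nonneg [ConnectedSpace M]
    (hg : g.IsRiemannian) (hc : IsGeodesicallyComplete g.leviCivita)
    (hRic : ∀ (x : M) (w : TangentSpace 𝓘(ℝ, E) x), 0 ≤ g.leviCivita.ricci x w w)
    {p x : M} (hxp : x ≠ p) {G G' : ℝ → ℝ} {G2 δ : ℝ} (hδ : 0 < δ)
    (hGd : ∀ s ∈ Ioo ((g.edist hg p x).toReal - δ) ((g.edist hg p x).toReal + δ),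
      HasDerivAt G (G' s) s)
    (hG2 : HasDerivAt G' G2 (g.edist hg p x).toReal)
    (hanti : AntitoneOn G (Ioo ((g.edist hg p x).toReal - δ) ((g.edist hg p x).toReal + δ)))
    {φ : M → ℝ} (hφ : ∀ᶠ x' in 𝓝 x, ContMDiffAt 𝓘(ℝ, E) 𝓘(ℝ, ℝ) 2 φ x')
    (hmax : IsLocalMax (fun x' ↦ G (g.edist hg p x').toReal - φ x') x) :
    G2 + ((Module.finrank ℝ E : ℝ) - 1) * (1 / (g.edist hg p x).toReal) *
        G' (g.edist hg p x).toReal ≤ g.laplaceBeltrami φ x := by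
  obtain ⟨u, T, hu, hT, hTx, hx⟩ := exists_unit_speed_expMap_eq_of_ne g hg hc hxp
  subst hx
  obtain ⟨k, f, Q, hcard, hon, -, hrad, hbar, hsum⟩ :=
    far_end_linear_datum_of_ricci_nonneg g hg hc hRic p u hu hT
  rw [← hTx] at hGd hG2 hanti ⊢
  exact le_laplaceBeltrami_of_directional_barriers_antitone g hg hc hT hTx hcard hon hrad hbar hsum
    hδ hGd hG2 hanti hφ hmax

/-- **Laplacian comparison for nondecreasing radial functions, `Ric ≥ -(m-1) g`, viscosity
form**: for `G` nondecreasing near `T = d(p, x)`, `x ≠ p`, and every `φ`, `C²` near `x`, such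
that `G ∘ d(p, ·) - φ` has a local minimum at `x`:
`Δ_g φ(x) ≤ G''(T) + (m - 1) coth(T) G'(T)` (`G = id`: `laplaceBeltrami_le_coth_of_le_edist`).
[cite: CheegerColding1996, §1] [cite: Calabi1958] -/
theorem laplaceBeltrami_le_comp_edist_of_monotone [ConnectedSpace M] (hg : g.IsRiemannian)
    (hc : IsGeodesicallyComplete g.leviCivita)
    (hRic : ∀ (x : M) (w : TangentSpace 𝓘(ℝ, E) x),
      -((Module.finrank ℝ E : ℝ) - 1) * g.val x w w ≤ g.leviCivita.ricci x w w)
    {p x : M} (hxp : x ≠ p) {G G' : ℝ → ℝ} {G2 δ : ℝ} (hδ : 0 < δ)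
    (hGd : ∀ s ∈ Ioo ((g.edist hg p x).toReal - δ) ((g.edist hg p x).toReal + δ),
      HasDerivAt G (G' s) s)
    (hG2 : HasDerivAt G' G2 (g.edist hg p x).toReal)
    (hmono : MonotoneOn G (Ioo ((g.edist hg p x).toReal - δ) ((g.edist hg p x).toReal + δ)))
    {φ : M → ℝ} (hφ : ∀ᶠ x' in 𝓝 x, ContMDiffAt 𝓘(ℝ, E) 𝓘(ℝ, ℝ) 2 φ x')
    (hmin : IsLocalMin (fun x' ↦ G (g.edist hg p x').toReal - φ x') x) :
    g.laplaceBeltrami φ x ≤ G2 + ((Module.finrank ℝ E : ℝ) - 1) *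
      (Real.cosh (g.edist hg p x).toReal / Real.sinh (g.edist hg p x).toReal) *
        G' (g.edist hg p x).toReal := by
  obtain ⟨u, T, hu, hT, hTx, hx⟩ := exists_unit_speed_expMap_eq_of_ne g hg hc hxp
  subst hx
  obtain ⟨k, f, Q, hcard, hon, -, hrad, hbar, hsum⟩ := far_end_sinh_datum g hg hc hRic p u hu hT
  rw [← hTx] at hGd hG2 hmono ⊢
  exact laplaceBeltrami_le_of_directional_barriers_monotone g hg hc hT hTx hcard hon hrad hbar hsum
    hδ hGd hG2 hmono hφ hmin

/-- **Laplacian comparison for nondecreasing radial functions, `Ric ≥ 0`, viscosity form**: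
`Δ_g φ(x) ≤ G''(T) + ((m - 1)/T) G'(T)`. [cite: CheegerColding1996, §1] [cite: Calabi1958] -/
theorem laplaceBeltrami_le_comp_edist_of_monotone_of_ricci_nonneg [ConnectedSpace M]
    (hg : g.IsRiemannian) (hc : IsGeodesicallyComplete g.leviCivita)
    (hRic : ∀ (x : M) (w : TangentSpace 𝓘(ℝ, E) x), 0 ≤ g.leviCivita.ricci x w w)
    {p x : M} (hxp : x ≠ p) {G G' : ℝ → ℝ} {G2 δ : ℝ} (hδ : 0 < δ)
    (hGd : ∀ s ∈ Ioo ((g.edist hg p x).toReal - δ) ((g.edist hg p x).toReal + δ),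
      HasDerivAt G (G' s) s)
    (hG2 : HasDerivAt G' G2 (g.edist hg p x).toReal)
    (hmono : MonotoneOn G (Ioo ((g.edist hg p x).toReal - δ) ((g.edist hg p x).toReal + δ)))
    {φ : M → ℝ} (hφ : ∀ᶠ x' in 𝓝 x, ContMDiffAt 𝓘(ℝ, E) 𝓘(ℝ, ℝ) 2 φ x')
    (hmin : IsLocalMin (fun x' ↦ G (g.edist hg p x').toReal - φ x') x) :
    g.laplaceBeltrami φ x ≤ G2 + ((Module.finrank ℝ E : ℝ) - 1) * (1 / (g.edist hg p x).toReal) *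
        G' (g.edist hg p x).toReal := by
  obtain ⟨u, T, hu, hT, hTx, hx⟩ := exists_unit_speed_expMap_eq_of_ne g hg hc hxp
  subst hx
  obtain ⟨k, f, Q, hcard, hon, -, hrad, hbar, hsum⟩ :=
    far_end_linear_datum_of_ricci_nonneg g hg hc hRic p u hu hT
  rw [← hTx] at hGd hG2 hmono ⊢
  exact laplaceBeltrami_le_of_directional_barriers_monotone g hg hc hT hTx hcard hon hrad hbar hsum
    hδ hGd hG2 hmono hφ hmin

end Radial

/-! ### The comparison principle against smooth strict supersolutions and subsolutions -/

section Comparison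

variable {E : Type*} [NormedAddCommGroup E] [NormedSpace ℝ E] {H : Type*} [TopologicalSpace H]
  {I : ModelWithCorners ℝ E H} {M : Type*} [TopologicalSpace M] [ChartedSpace H M]
  [IsManifold I ∞ M] [FiniteDimensional ℝ E]
  (g : PseudoRiemannianMetric I ∞ E (TangentSpace I : M → Type _))

/-- **Comparison principle (viscosity subsolution vs. smooth strict supersolution)** — the
maximum-principle step of Calabi 1958 / Cheeger–Colding 1996, §1: let `K` be compact, `Ω ⊆ K`
open, `u - b` upper semicontinuous on `K` (e.g. `u`, `b` continuous), `u ≤ b` on `K ∖ Ω`, `b` of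
class `C²` near every point of `Ω` with `Δ_g b < F` on `Ω`, and `u` a viscosity subsolution of
`Δ u ≥ F` on `Ω`: for every `x ∈ Ω` and every `φ`, `C²` near `x`, such that `u - φ` has a local
maximum at `x`, `F(x) ≤ Δ_g φ(x)`. Then `u ≤ b` on `K` (a positive maximum of `u - b` on `K`
lies in `Ω` and is a local maximum of `u - b`, so `F ≤ Δ_g b < F` there).
[cite: CheegerColding1996, §1] [cite: Calabi1958] -/
theorem le_of_viscosity_subsolution {K Ω : Set M} (hK : IsCompact K) (hΩK : Ω ⊆ K)
    (hΩ : IsOpen Ω) {u b F : M → ℝ} (husc : UpperSemicontinuousOn (fun x ↦ u x - b x) K)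
    (hbdry : ∀ x ∈ K \ Ω, u x ≤ b x)
    (hb : ∀ x ∈ Ω, ContMDiffAt I 𝓘(ℝ, ℝ) 2 b x) (hΔb : ∀ x ∈ Ω, g.laplaceBeltrami b x < F x)
    (hsub : ∀ x ∈ Ω, ∀ φ : M → ℝ, (∀ᶠ x' in 𝓝 x, ContMDiffAt I 𝓘(ℝ, ℝ) 2 φ x') →
      IsLocalMax (fun x' ↦ u x' - φ x') x → F x ≤ g.laplaceBeltrami φ x) :
    ∀ x ∈ K, u x ≤ b x := by
  by_contra hcon
  simp only [not_forall, not_le, exists_prop] at hcon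
  obtain ⟨x₁, hx₁K, hx₁⟩ := hcon
  obtain ⟨x₀, hx₀K, hmax⟩ := husc.exists_isMaxOn ⟨x₁, hx₁K⟩ hK
  have hpos : 0 < u x₀ - b x₀ := lt_of_lt_of_le (by linarith) (hmax hx₁K)
  have hx₀Ω : x₀ ∈ Ω := by
    by_contra h
    have := hbdry x₀ ⟨hx₀K, h⟩
    linarith
  have hφ : ∀ᶠ x' in 𝓝 x₀, ContMDiffAt I 𝓘(ℝ, ℝ) 2 b x' := by
    filter_upwards [hΩ.mem_nhds hx₀Ω] with x' hx' using hb x' hx'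
  have hloc : IsLocalMax (fun x' ↦ u x' - b x') x₀ := by
    filter_upwards [hΩ.mem_nhds hx₀Ω] with x' hx' using hmax (hΩK hx')
  have h := hsub x₀ hx₀Ω b hφ hloc
  linarith [hΔb x₀ hx₀Ω]

/-- **Comparison principle (viscosity supersolution vs. smooth strict subsolution)**, the mirror
statement: `b - u` upper semicontinuous on the compact `K`, `b ≤ u` on `K ∖ Ω`, `b ∈ C²` on the
open `Ω ⊆ K` with `Δ_g b > F` there, and for every `x ∈ Ω` and every `φ`, `C²` near `x`, such
that `u - φ` has a local minimum at `x`, `Δ_g φ(x) ≤ F(x)` (e.g. `u = d(p, ·)`,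
`F = (m-1) coth d(p, ·)`, `laplaceBeltrami_le_coth_of_le_edist`). Then `b ≤ u` on `K`.
[cite: CheegerColding1996, §1] [cite: Calabi1958] -/
theorem le_of_viscosity_supersolution {K Ω : Set M} (hK : IsCompact K) (hΩK : Ω ⊆ K)
    (hΩ : IsOpen Ω) {u b F : M → ℝ} (husc : UpperSemicontinuousOn (fun x ↦ b x - u x) K)
    (hbdry : ∀ x ∈ K \ Ω, b x ≤ u x)
    (hb : ∀ x ∈ Ω, ContMDiffAt I 𝓘(ℝ, ℝ) 2 b x) (hΔb : ∀ x ∈ Ω, F x < g.laplaceBeltrami b x)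
    (hsuper : ∀ x ∈ Ω, ∀ φ : M → ℝ, (∀ᶠ x' in 𝓝 x, ContMDiffAt I 𝓘(ℝ, ℝ) 2 φ x') →
      IsLocalMin (fun x' ↦ u x' - φ x') x → g.laplaceBeltrami φ x ≤ F x) :
    ∀ x ∈ K, b x ≤ u x := by
  by_contra hcon
  simp only [not_forall, not_le, exists_prop] at hcon
  obtain ⟨x₁, hx₁K, hx₁⟩ := hcon
  obtain ⟨x₀, hx₀K, hmax⟩ := husc.exists_isMaxOn ⟨x₁, hx₁K⟩ hK
  have hpos : 0 < b x₀ - u x₀ := lt_of_lt_of_le (by linarith) (hmax hx₁K)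
  have hx₀Ω : x₀ ∈ Ω := by
    by_contra h
    have := hbdry x₀ ⟨hx₀K, h⟩
    linarith
  have hφ : ∀ᶠ x' in 𝓝 x₀, ContMDiffAt I 𝓘(ℝ, ℝ) 2 b x' := by
    filter_upwards [hΩ.mem_nhds hx₀Ω] with x' hx' using hb x' hx'
  have hloc : IsLocalMin (fun x' ↦ u x' - b x') x₀ := by
    filter_upwards [hΩ.mem_nhds hx₀Ω] with x' hx'
    have h1 : b x' - u x' ≤ b x₀ - u x₀ := hmax (hΩK hx')
    linarith
  have h := hsuper x₀ hx₀Ω b hφ hloc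
  linarith [hΔb x₀ hx₀Ω]

end Comparison

end Literature.Geometry.Riemannian

end
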